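import Mathlib
import HarnessLib
import Literature.Analysis.FluidPDE.TypeIAncientMild
import Summits.NavierStokesRegularity.NavierStokesRegularity.Theorems.PoloidalWindowDoorPoloidalWindowRigidityIsometryAxisRotation

/-!
# Route `PoloidalWindowDoor`, crux `PoloidalWindowRigidity` (K2, stmt-NavierStokesRegularity-19708) — LINE 7 `period_door`
# (ns-idea-8 g3, v3; critic idea-crit-7 g2 PASS-WITH-PRICE 2026-08-28T13:57Z), STUB D1F `stub_killingOfDiscreteRotation`:
# a discrete Euclidean symmetry of INFINITE ORDER with a fixed point integrates to a Killing ROTATION symmetry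

Cell ns-regularity-ideate, seat ns-poloidal-K2-p2 g12 (stub-worker on K2; `--supports` the crux item).  Statement VERBATIM
`Cruxes/PoloidalWindowRigidity/Lines/period_door.lean` v3 l.167–175; with it the line's `rotationDoor` (via the PROVED item
`AxisymEndLiouville`, stmt-NavierStokesRegularity-14061) and `symmetryDoor` become unconditional (landed separately).

Contents: differentiability of the slices of a Type-I ancient mild field (`hasFDerivAt_slice`) and the stub; the geometry on
`ℝ³ = EuclideanSpace ℝ (Fin 3)` (explicit rotation family `rot_add` / `rot_zero` / `rot_int_mul_two_pi` / `continuous_rot` /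
`hasDerivAt_rot_zero`, the frame `exists_frame`, the normal form `rotation_of_fix`) is part 1,
`…PoloidalWindowDoorPoloidalWindowRigidityIsometryAxisRotation`; the unit axis of a linear isometry of `ℝ³` (`exists_unit_axis`,
Euler's rotation-axis theorem by determinants) is proved here.

WHAT THIS IS NOT: not a claim about Navier–Stokes regularity — finite-dimensional geometry (normal form of an infinite-order
element of `O(3)`, Kronecker density via `AddSubgroup.dense_or_cyclic`, closedness of the equivariance group of a continuous
slice, one derivative) for one provable stub of an ideator line of a door route (bears_on LADDER-NS N0, rung
N0-LocalTubeDoorPoloidal).  The line's research residues `stub_asymmetricHypThick` / `stub_asymmetricSemiThick` and the shared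
`stub_hyperbolicTH` stay OPEN; crux 19708 is OPEN.
-/

noncomputable section

-- the summit and its single sub-problem share the name (CONVENTIONS §1), as in every Theorems file
set_option linter.dupNamespace false

namespace Summit.NavierStokesRegularity.NavierStokesRegularity.Theorems.PoloidalWindowDoorPoloidalWindowRigidityKillingOfDiscreteRotation

open scoped RealInnerProductSpace InnerProductSpace
open Set Function Filter Topology Module
open Summit.NavierStokesRegularity.NavierStokesRegularity.Theorems.PoloidalWindowDoorPoloidalWindowRigidityIsometryAxisRotation
/-- **Unit axis of a linear isometry of `ℝ³`** (Euler): some unit vector is mapped to itself or to its negative.  By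
determinants: `‖det A‖ = 1` (`LinearIsometry.normDet_eq_one`), `adjoint A = A⁻¹`, `det ∘ adjoint = det` (transpose in an
orthonormal basis), and `A⁻¹ ∓ 1 = A⁻¹ ∘ (1 ∓ A)` give `det (A − 1) = −det (A − 1)` when `det A = 1` and
`det (A + 1) = −det (A + 1)` when `det A = −1`; a vanishing determinant yields a kernel vector
(`LinearMap.bot_lt_ker_of_det_eq_zero`), which is then normalised.  (A non-normalised variant with a characteristic-polynomial
proof exists in the `AngularGalerkinLadder` cone; it is not imported here to keep this file route-independent.) [folklore] -/
theorem exists_unit_axis (A : EuclideanSpace ℝ (Fin 3) ≃ₗᵢ[ℝ] EuclideanSpace ℝ (Fin 3)) :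
    ∃ e : EuclideanSpace ℝ (Fin 3), ‖e‖ = 1 ∧ (A e = e ∨ A e = -e) := by
  -- it suffices to find a non-zero such vector
  suffices h : ∃ e : EuclideanSpace ℝ (Fin 3), e ≠ 0 ∧ (A e = e ∨ A e = -e) by
    obtain ⟨e₀, he₀, hAe₀⟩ := h
    refine ⟨‖e₀‖⁻¹ • e₀, ?_, ?_⟩
    · rw [norm_smul, norm_inv, norm_norm, inv_mul_cancel₀ (norm_ne_zero_iff.2 he₀)]
    · rcases hAe₀ with h | h
      · exact Or.inl (by rw [map_smul, h])
      · exact Or.inr (by rw [map_smul, h, smul_neg])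
  -- the determinant of the adjoint equals the determinant
  have det_adjoint_eq : ∀ M : EuclideanSpace ℝ (Fin 3) →ₗ[ℝ] EuclideanSpace ℝ (Fin 3),
      LinearMap.det (LinearMap.adjoint M) = LinearMap.det M := by
    intro M
    let b := EuclideanSpace.basisFun (Fin 3) ℝ
    rw [← LinearMap.det_toMatrix b.toBasis, LinearMap.toMatrix_adjoint, Matrix.det_conjTranspose,
      LinearMap.det_toMatrix, star_trivial]
  set L : EuclideanSpace ℝ (Fin 3) →ₗ[ℝ] EuclideanSpace ℝ (Fin 3) :=
    A.toLinearIsometry.toLinearMap with hL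
  set L' : EuclideanSpace ℝ (Fin 3) →ₗ[ℝ] EuclideanSpace ℝ (Fin 3) :=
    A.symm.toLinearIsometry.toLinearMap with hL'
  have hLapp : ∀ x, L x = A x := fun x => rfl
  have hL'app : ∀ x, L' x = A.symm x := fun x => rfl
  have hL'L : L'.comp L = LinearMap.id := by
    ext x
    simp only [LinearMap.comp_apply, hLapp, hL'app, LinearIsometryEquiv.symm_apply_apply,
      LinearMap.id_apply]
  -- `‖det L‖ = 1`
  have hnd : ‖LinearMap.det L‖ = 1 := by
    rw [← LinearMap.normDet_eq_norm_det]; exact A.toLinearIsometry.normDet_eq_one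
  have hd : LinearMap.det L = 1 ∨ LinearMap.det L = -1 := by
    rcases (abs_eq (zero_le_one : (0:ℝ) ≤ 1)).1 (by simpa [Real.norm_eq_abs] using hnd) with h | h
    · exact Or.inl h
    · exact Or.inr h
  -- the adjoint of `L` is `L'`
  have hadj : L' = LinearMap.adjoint L := by
    rw [LinearMap.eq_adjoint_iff]
    intro x y
    rw [hL'app, hLapp, ← A.inner_map_map (A.symm x) y, LinearIsometryEquiv.apply_symm_apply]
  have hid : (LinearMap.id : EuclideanSpace ℝ (Fin 3) →ₗ[ℝ] EuclideanSpace ℝ (Fin 3)) =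
      LinearMap.adjoint LinearMap.id := by
    rw [LinearMap.eq_adjoint_iff]; intro x y; rfl
  have hdetL' : LinearMap.det L' = LinearMap.det L := by rw [hadj, det_adjoint_eq]
  have hfin : Module.finrank ℝ (EuclideanSpace ℝ (Fin 3)) = 3 := finrank_euclideanSpace_fin
  -- `det (-M) = - det M` in dimension three
  have hneg : ∀ M : EuclideanSpace ℝ (Fin 3) →ₗ[ℝ] EuclideanSpace ℝ (Fin 3),
      LinearMap.det (-M) = -LinearMap.det M := by
    intro M
    rw [show -M = (-1 : ℝ) • M by rw [neg_one_smul], LinearMap.det_smul, hfin]; norm_num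
  rcases hd with hd | hd
  · -- `det L = 1`: `det (L - id) = 0`
    have e1 : L' - LinearMap.id = L'.comp (LinearMap.id - L) := by
      rw [LinearMap.comp_sub, hL'L, LinearMap.comp_id]
    have e2 : LinearMap.adjoint (L - LinearMap.id) = L' - LinearMap.id := by
      rw [map_sub, ← hadj, ← hid]
    have e3 : LinearMap.det (L - LinearMap.id) = 0 := by
      have h1 : LinearMap.det (L - LinearMap.id) = LinearMap.det (L' - LinearMap.id) := by
        rw [← e2, det_adjoint_eq]
      have h2 : LinearMap.det (L' - LinearMap.id) =
          LinearMap.det L' * LinearMap.det (LinearMap.id - L) := by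
        rw [e1, LinearMap.det_comp]
      have h3 : LinearMap.det (LinearMap.id - L) = -LinearMap.det (L - LinearMap.id) := by
        rw [← hneg, neg_sub]
      rw [h2, hdetL', hd, one_mul, h3] at h1
      linarith
    obtain ⟨e, he, hne⟩ := Submodule.exists_mem_ne_zero_of_ne_bot
      (ne_of_gt (LinearMap.bot_lt_ker_of_det_eq_zero e3))
    refine ⟨e, hne, Or.inl ?_⟩
    have := LinearMap.mem_ker.mp he
    rw [LinearMap.sub_apply, LinearMap.id_apply, sub_eq_zero, hLapp] at this
    exact this
  · -- `det L = -1`: `det (L + id) = 0`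
    have e1 : L' + LinearMap.id = L'.comp (LinearMap.id + L) := by
      rw [LinearMap.comp_add, hL'L, LinearMap.comp_id, add_comm]
    have e2 : LinearMap.adjoint (L + LinearMap.id) = L' + LinearMap.id := by
      rw [map_add, ← hadj, ← hid]
    have e3 : LinearMap.det (L + LinearMap.id) = 0 := by
      have h1 : LinearMap.det (L + LinearMap.id) = LinearMap.det (L' + LinearMap.id) := by
        rw [← e2, det_adjoint_eq]
      have h2 : LinearMap.det (L' + LinearMap.id) =
          LinearMap.det L' * LinearMap.det (LinearMap.id + L) := by
        rw [e1, LinearMap.det_comp]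
      rw [h2, hdetL', hd, add_comm LinearMap.id L] at h1
      linarith
    obtain ⟨e, he, hne⟩ := Submodule.exists_mem_ne_zero_of_ne_bot
      (ne_of_gt (LinearMap.bot_lt_ker_of_det_eq_zero e3))
    refine ⟨e, hne, Or.inr ?_⟩
    have := LinearMap.mem_ker.mp he
    rw [LinearMap.add_apply, LinearMap.id_apply, add_eq_zero_iff_eq_neg, hLapp] at this
    exact this


/-- Slices `v t`, `t < 0`, of a Type-I ancient mild field are differentiable (joint `C^∞` on the open slab `{t < 0} × ℝ³`). [folklore] -/
theorem hasFDerivAt_slice {C : ℝ} {v : ℝ → EuclideanSpace ℝ (Fin 3) → EuclideanSpace ℝ (Fin 3)}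
    (hv : Literature.Analysis.FluidPDE.IsTypeIAncientMild C v) {t : ℝ} (ht : t < 0)
    (x : EuclideanSpace ℝ (Fin 3)) : HasFDerivAt (v t) (fderiv ℝ (v t) x) x := by
  have hopen : IsOpen (Iio (0 : ℝ) ×ˢ (univ : Set (EuclideanSpace ℝ (Fin 3)))) :=
    isOpen_Iio.prod isOpen_univ
  have hat : ContDiffAt ℝ (⊤ : ℕ∞) (uncurry v) (t, x) :=
    hv.1.contDiffAt (hopen.mem_nhds (mk_mem_prod ht (mem_univ _)))
  have h1 : ContDiffAt ℝ (⊤ : ℕ∞) (fun y : EuclideanSpace ℝ (Fin 3) => uncurry v (t, y)) x :=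
    hat.comp x (contDiffAt_const.prodMk contDiffAt_id)
  exact (h1.differentiableAt (by simp)).hasFDerivAt

/-- **STUB D1F `stub_killingOfDiscreteRotation` of LINE 7 `period_door` v3 (crux `PoloidalWindowRigidity`, stmt-NavierStokesRegularity-19708),
VERBATIM (`Cruxes/PoloidalWindowRigidity/Lines/period_door.lean` l.167–175).**  A Type-I ancient mild field `v ∈ A_C` that is
equivariant under a Euclidean isometry `x ↦ A (x - c) + c` with `A` a linear isometry of INFINITE ORDER is annihilated, on every
slice, by a non-zero skew generator `K` of rotations about an axis through `c`: `Dv(t)(x)[K (x - c)] = K (v t x)`.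
PROOF.  `exists_unit_axis` (Euler, by determinants): a unit `e` with `A e = ± e`; `B := A ∘ A` fixes `e`, has infinite order
(`B^[k] = A^[2k]`) and `v` is `B`-equivariant.  `exists_frame` + `rotation_of_fix`: in an orthonormal frame `(u, w, e)`, `B` is the
rotation `R_β` of the explicit family `R_θ y = y + (cos θ − 1)(⟪u,y⟫u + ⟪w,y⟫w) + sin θ (⟪u,y⟫w − ⟪w,y⟫u)` (the involutive alternative
is excluded by `B ∘ B ≠ id`), and `B^[k] = R_{kβ}` (`rot_add`).  The set `S` of angles `θ` for which every slice is `R_θ`-equivariant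
about `c` is an additive subgroup of `ℝ` (group law), CLOSED (slices are continuous: joint smoothness of `A_C` on the open slab),
and contains `β` and `2π`.  By `AddSubgroup.dense_or_cyclic`, either `S` is dense — then `S = ℝ` — or `S = ℤg`, in which case
`nβ ∈ 2πℤ` for some `n ≠ 0` and `B^[|n|] = id`, contradicting the infinite order.  Differentiating `v t (R_θ (x − c) + c) = R_θ (v t x)`
at `θ = 0` (chain rule on the differentiable slice, `hasDerivAt_rot_zero`, uniqueness of derivatives) gives the Killing identity
with `K y = ⟪u,y⟫ w − ⟪w,y⟫ u` (`= (innerSL ℝ u).smulRight w − (innerSL ℝ w).smulRight u`), which is skew (`⟪K y, y⟫ = 0`) and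
non-zero (`K u = w`).  Finite-dimensional geometry + continuity + one derivative; no PDE is used. [folklore] -/
theorem stub_killingOfDiscreteRotation :
    ∀ (C : ℝ) (v : ℝ → EuclideanSpace ℝ (Fin 3) → EuclideanSpace ℝ (Fin 3)),
      Literature.Analysis.FluidPDE.IsTypeIAncientMild C v →
      ∀ (A : EuclideanSpace ℝ (Fin 3) ≃ₗᵢ[ℝ] EuclideanSpace ℝ (Fin 3)) (c : EuclideanSpace ℝ (Fin 3)),
        (∀ q : ℕ, 0 < q → ∃ x, (fun y => A y)^[q] x ≠ x) →
        (∀ t : ℝ, t < 0 → ∀ x, v t (A (x - c) + c) = A (v t x)) →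
        ∃ K : EuclideanSpace ℝ (Fin 3) →L[ℝ] EuclideanSpace ℝ (Fin 3), (∀ x, ⟪K x, x⟫_ℝ = 0) ∧ K ≠ 0 ∧
          ∀ t : ℝ, t < 0 → ∀ x, fderiv ℝ (v t) x (K (x - c)) - K (v t x) = 0 := by
  intro C v hv A c hA hsym
  -- slices are differentiable, hence continuous
  have hdiff : ∀ t < (0:ℝ), ∀ x, HasFDerivAt (v t) (fderiv ℝ (v t) x) x :=
    fun t ht x => hasFDerivAt_slice hv ht x
  have hcont : ∀ t < (0:ℝ), Continuous (v t) := fun t ht =>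
    continuous_iff_continuousAt.2 fun x => (hdiff t ht x).continuousAt
  -- the axis of `A`, and `B := A ∘ A` fixing it
  obtain ⟨e, he, hAe⟩ := exists_unit_axis A
  set B := A.trans A with hB_def
  have hBapp : ∀ y, B y = A (A y) := fun y => rfl
  have hBe : B e = e := by
    rw [hBapp]
    rcases hAe with h | h
    · rw [h, h]
    · rw [h, map_neg, h, neg_neg]
  have hBsym : ∀ t < (0:ℝ), ∀ x, v t (B (x - c) + c) = B (v t x) := by
    intro t ht x
    have h1 := hsym t ht (A (x - c) + c)
    rw [add_sub_cancel_right, hsym t ht x] at h1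
    rw [hBapp, hBapp]; exact h1
  have hBiter : ∀ k : ℕ, ∀ y, (fun y => B y)^[k] y = (fun y => A y)^[2 * k] y := by
    intro k y
    rw [Function.iterate_mul]
    rfl
  have hBord : ∀ k : ℕ, 0 < k → ∃ x, (fun y => B y)^[k] x ≠ x := by
    intro k hk
    obtain ⟨x, hx⟩ := hA (2 * k) (by omega)
    exact ⟨x, by rw [hBiter]; exact hx⟩
  have hB2 : ∃ x, B (B x) ≠ x := by
    obtain ⟨x, hx⟩ := hBord 2 two_pos
    exact ⟨x, hx⟩
  -- the frame and the rotation structure of `B`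
  obtain ⟨u, w, hu, hw, huw, heu, hew, hexp⟩ := exists_frame e he
  obtain ⟨a, b, hab, hBrot⟩ := rotation_of_fix B hu hw huw heu hew hexp hBe hB2
  -- the angle
  obtain ⟨β, hcos, hsin⟩ : ∃ β : ℝ, Real.cos β = a ∧ Real.sin β = b := by
    have hz : (⟨a, b⟩ : ℂ) ≠ 0 := by
      intro h
      have h1 : a = 0 := by simpa using congrArg Complex.re h
      have h2 : b = 0 := by simpa using congrArg Complex.im h
      rw [h1, h2] at hab; norm_num at hab
    have hn : ‖(⟨a, b⟩ : ℂ)‖ = 1 := by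
      rw [Complex.norm_eq_sqrt_sq_add_sq]; simp [hab]
    refine ⟨Complex.arg ⟨a, b⟩, ?_, ?_⟩
    · rw [Complex.cos_arg hz, hn]; simp
    · rw [Complex.sin_arg, hn]; simp
  -- the rotation family
  set R : ℝ → EuclideanSpace ℝ (Fin 3) → EuclideanSpace ℝ (Fin 3) := fun θ y =>
    y + (Real.cos θ - 1) • (⟪u, y⟫_ℝ • u + ⟪w, y⟫_ℝ • w) + Real.sin θ • (⟪u, y⟫_ℝ • w - ⟪w, y⟫_ℝ • u)
    with hR_def
  have hR : ∀ θ y, R θ y = y + (Real.cos θ - 1) • (⟪u, y⟫_ℝ • u + ⟪w, y⟫_ℝ • w)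
      + Real.sin θ • (⟪u, y⟫_ℝ • w - ⟪w, y⟫_ℝ • u) := fun θ y => rfl
  have hBR : ∀ y, B y = R β y := by intro y; rw [hBrot y, hR, hcos, hsin]
  have hBk : ∀ k : ℕ, ∀ y, (fun y => B y)^[k] y = R (k * β) y := by
    intro k
    induction k with
    | zero => intro y; simp [rot_zero hR]
    | succ k ih =>
      intro y
      rw [Function.iterate_succ_apply', ih, hBR, rot_add hR hu hw huw]
      push_cast
      ring_nf
  -- the equivariance subgroup
  let S : AddSubgroup ℝ :=
    { carrier := {θ | ∀ t < (0:ℝ), ∀ x, v t (R θ (x - c) + c) = R θ (v t x)}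
      zero_mem' := by
        intro t ht x
        simp only [rot_zero hR, sub_add_cancel]
      add_mem' := by
        intro θ φ hθ hφ t ht x
        have h1 := hθ t ht (R φ (x - c) + c)
        rw [add_sub_cancel_right, hφ t ht x, rot_add hR hu hw huw, rot_add hR hu hw huw] at h1
        exact h1
      neg_mem' := by
        intro θ hθ t ht x
        have h1 := hθ t ht (R (-θ) (x - c) + c)
        rw [add_sub_cancel_right, rot_add hR hu hw huw, add_neg_cancel, rot_zero hR,
          sub_add_cancel] at h1
        rw [h1, rot_add hR hu hw huw, neg_add_cancel, rot_zero hR] }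
  have hSmem : ∀ θ, θ ∈ S ↔ ∀ t < (0:ℝ), ∀ x, v t (R θ (x - c) + c) = R θ (v t x) :=
    fun θ => Iff.rfl
  have hSclosed : IsClosed (S : Set ℝ) := by
    have : (S : Set ℝ) = ⋂ t : ℝ, ⋂ (_ : t < 0), ⋂ x : EuclideanSpace ℝ (Fin 3),
        {θ | v t (R θ (x - c) + c) = R θ (v t x)} := by
      ext θ; simp only [mem_iInter, mem_setOf_eq]; exact hSmem θ
    rw [this]
    refine isClosed_iInter fun t => isClosed_iInter fun ht => isClosed_iInter fun x => ?_
    exact isClosed_eq ((hcont t ht).comp ((continuous_rot hR (x - c)).add continuous_const))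
      (continuous_rot hR (v t x))
  have hβS : β ∈ S := by
    intro t ht x
    rw [← hBR, ← hBR]; exact hBsym t ht x
  have h2πS : 2 * Real.pi ∈ S := by
    intro t ht x
    have h := rot_int_mul_two_pi hR 1
    push_cast at h; simp only [one_mul] at h
    rw [h, h, sub_add_cancel]
  -- `S = ℝ`
  have hSall : ∀ θ, θ ∈ S := by
    rcases AddSubgroup.dense_or_cyclic S with hdense | ⟨g, hg⟩
    · intro θ
      have : θ ∈ closure (S : Set ℝ) := by rw [hdense.closure_eq]; exact mem_univ _
      rwa [hSclosed.closure_eq] at this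
    · exfalso
      have hβ' : β ∈ AddSubgroup.closure {g} := hg ▸ hβS
      have h2π' : 2 * Real.pi ∈ AddSubgroup.closure {g} := hg ▸ h2πS
      obtain ⟨m, hm⟩ := AddSubgroup.mem_closure_singleton.1 hβ'
      obtain ⟨n, hn⟩ := AddSubgroup.mem_closure_singleton.1 h2π'
      have hn0 : n ≠ 0 := by
        rintro rfl
        rw [zero_zsmul] at hn
        exact Real.pi_ne_zero (by linarith)
      have hnβ : (n : ℝ) * β = m * (2 * Real.pi) := by
        rw [← hm, ← hn]; simp only [zsmul_eq_mul]; ring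
      -- `B^[|n|] = id`
      set k := n.natAbs with hk
      have hkpos : 0 < k := Int.natAbs_pos.2 hn0
      have hkR : ((k : ℕ) : ℝ) = |(n : ℝ)| := by
        rw [hk, ← Int.cast_natCast (R := ℝ), Int.natCast_natAbs, Int.cast_abs]
      have hkβ : ∃ m' : ℤ, (k : ℝ) * β = m' * (2 * Real.pi) := by
        rcases abs_choice (n : ℝ) with h | h
        · exact ⟨m, by rw [hkR, h, hnβ]⟩
        · exact ⟨-m, by rw [hkR, h, neg_mul, hnβ]; push_cast; ring⟩
      obtain ⟨m', hm'⟩ := hkβ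
      obtain ⟨x, hx⟩ := hBord k hkpos
      apply hx
      rw [hBk, hm', rot_int_mul_two_pi hR]
  -- the generator
  let K : EuclideanSpace ℝ (Fin 3) →L[ℝ] EuclideanSpace ℝ (Fin 3) :=
    (innerSL ℝ u).smulRight w - (innerSL ℝ w).smulRight u
  have hK : ∀ y, K y = ⟪u, y⟫_ℝ • w - ⟪w, y⟫_ℝ • u := by
    intro y; simp [K]
  refine ⟨K, fun x => ?_, ?_, fun t ht x => ?_⟩
  · rw [hK, inner_sub_left, real_inner_smul_left, real_inner_smul_left]; ring
  · intro h0
    have h1 : K u = 0 := by rw [h0]; rfl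
    rw [hK, real_inner_self_eq_norm_sq, hu, one_pow, one_smul, real_inner_comm, huw, zero_smul,
      sub_zero] at h1
    rw [h1, norm_zero] at hw; exact zero_ne_one hw
  · -- differentiate the equivariance `v t (R θ (x - c) + c) = R θ (v t x)` at `θ = 0`
    have heq : (fun θ => v t (R θ (x - c) + c)) = fun θ => R θ (v t x) :=
      funext fun θ => hSall θ t ht x
    have hγ : HasDerivAt (fun θ => R θ (x - c) + c) (⟪u, x - c⟫_ℝ • w - ⟪w, x - c⟫_ℝ • u) 0 :=
      (hasDerivAt_rot_zero hR (x - c)).add_const c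
    have hγ0 : R 0 (x - c) + c = x := by rw [rot_zero hR, sub_add_cancel]
    have hf : HasFDerivAt (v t) (fderiv ℝ (v t) x) (R 0 (x - c) + c) := by
      rw [hγ0]; exact hdiff t ht x
    have hl : HasDerivAt (fun θ => v t (R θ (x - c) + c))
        (fderiv ℝ (v t) x (⟪u, x - c⟫_ℝ • w - ⟪w, x - c⟫_ℝ • u)) 0 :=
      hf.comp_hasDerivAt (0 : ℝ) hγ
    have hr : HasDerivAt (fun θ => R θ (v t x)) (⟪u, v t x⟫_ℝ • w - ⟪w, v t x⟫_ℝ • u) 0 :=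
      hasDerivAt_rot_zero hR (v t x)
    rw [heq] at hl
    rw [hK, hK, hl.unique hr, sub_self]


end Summit.NavierStokesRegularity.NavierStokesRegularity.Theorems.PoloidalWindowDoorPoloidalWindowRigidityKillingOfDiscreteRotation
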